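import Summits.HodgeConjecture.CorCM.ForeignQuadraticCMFieldsHodge
import Literature.AlgebraicGeometry.Pohlmann1968.SeparatingCMFamilies
import Literature.AlgebraicGeometry.Pohlmann1968.NondegenerateCMTypeHodgeConjecture
import Literature.AlgebraicGeometry.Motives.AbelianVarietyIsogenyProofs
import HarnessLib

/-!
# CM elliptic curves times ONE simple CM abelian variety of dimension `≤ 3` (or of prime dimension): Moonen–Zarhin's
# dichotomy — `B• = D•` on every product iff no curve field embeds in the CM field; otherwise exceptional classes

COR-CM (cell `pub-hodgecm2`, binder seat `b16` gen 37, count-neutral claim FOREIGN-IQ (F3)); NEW as stated, hence under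
`Summits/`.  Theorems only; no definition, no named fact, no `sorry`.

[MoonenZarhin1999LowDim, Thm. (0.2)]: for a complex abelian FOURFOLD `X ∼ X₁ × X₂`, `X₁` an elliptic curve with complex
multiplication by the imaginary quadratic field `k`, `X₂` a SIMPLE abelian threefold — case (a) "there exists an
embedding `k ↪ End⁰(X₂)`": the Hodge ring `B•(X)` is generated by divisor classes and the Weil classes `W_k ⊂ B²(X)`, and
"the Weil classes are really needed … `D²(X) ≠ B²(X)`"; case (4) (no such embedding): "`B•(Xⁿ) = D•(Xⁿ)` for all `n`".
This file is the CM case (`X₂` of CM type, `End⁰(X₂) = K` its sextic CM field), for ANY number of pairwise non-isogenous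
CM elliptic curves `E_a` (slots `a ≠ b`, imaginary quadratic `K_a`) and ONE simple CM abelian variety `A_b` of dimension
`2` or `3` — or of any PRIME dimension (Yanai) — all given as realisations `(A_i, ι_i, θ_i)` of CM types `Φ_i`, by name
from `CorCM/ForeignQuadraticCMFieldsHodge` (F2: the exact criterion `isNondegenerateFamily_iff_forall_isEmpty`), seat
b23's `SharedImaginaryQuadraticFamilies` (a shared imaginary quadratic field makes every family degenerate) and the
Hazama–Murty theorem of the tree (`CMAlgebra.exists_exceptional_prod_of_not_isNondegenerateFamily`):

* §1 (CM types) **`isNondegenerateFamily_iff_forall_isEmpty_of_finrank_le_six`** /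
  **`…_of_prime`**: for `Φ_b` PRIMITIVE on `K_b` of degree `≤ 6` (Ribet's bound) or `2p` (Yanai) and imaginary quadratic
  slots `a ≠ b` forming a separating sub-family, `(Φ_i)_i` is nondegenerate iff NO `K_a` embeds in `K_b`;
  `cmFamilyRank_add_card_eq_of_forall_isEmpty` — then `rank Hg(∏_a E_a × A_b) = r + dim A_b` (additivity).
* §2 (abelian varieties) `isSeparatingFamily_of_curves_of_isSimple` (pairwise non-isogenous curves and one simple
  `A_b` of dimension `≠ 1` give a separating family); **`forall_prod_hodgeClassSpan_eq_iff_forall_isEmpty_of_isSimple`** —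
  `Bᵐ ⊗ ℂ = Dᵐ ⊗ ℂ` on EVERY product `⨁_{j<N} A_{π j}` (every `∏_a E_a^{k_a} × A_b^c`) iff no `K_a` embeds in `K_b`
  (`A_b` simple of dimension `2` or `3`); **`hodgeConjectureFor_prod_of_forall_isEmpty_of_isSimple`** — then the Hodge
  conjecture holds for all these products, unconditionally; **`exists_exceptional_prod_of_ringHom_of_isSimple`** — an
  embedding `K_a ↪ K_b` forces a rational `(m,m)`-class OUTSIDE `Dᵐ ⊗ ℂ` on some product (Moonen–Zarhin's case (a),
  the Weil classes of `k = K_a`); **`hodgeConjectureFor_prod_or_exists_exceptional_of_isSimple`** — the DICHOTOMY; and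
  the prime-dimension twins `…_of_prime`.
* §3 the literal fourfold reading **`moonenZarhin_thm02_cm_threefold`** (`E` a CM elliptic curve, `T` a simple CM
  THREEFOLD, `[K_b : ℚ] = 6`): `B• = D•` on every `E^m × T^n` (and the Hodge conjecture) iff `IsEmpty (K_a →+* K_b)`.
New for NON-Galois sextic `K_b`: an imaginary quadratic field in `L_b ∖ K_b` (e.g. `√(−N_{F/ℚ}(α))` for `K_b = F(√−α)`)
admits no partial conjugation and no (□); the transitivity engine of `CMTypeRankForeignQuadraticSlot` decides.

## References

* [MoonenZarhin1999LowDim] B. Moonen, Yu. Zarhin, Math. Ann. 315 (1999) 711–733, Thm. (0.2) (a), (1), (4); Cor. (3.9).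
* [Gordon1999HodgeAVSurvey] B. B. Gordon, *A survey of the Hodge conjecture for abelian varieties*, §3, 7.4–7.7, 10.10.
* [Ribet1980] K. Ribet, §3 (3.7); [Yanai1985] H. Yanai, Nagoya Math. J. 97 (1985), §4 Theorem; [Shimura1998] §8.2 Prop. 26.
-/

noncomputable section

open CategoryTheory CategoryTheory.Limits NumberField NumberField.ComplexEmbedding IntermediateField
open scoped BigOperators

namespace Summit.HodgeConjecture.CorCM

open Literature.NumberTheory.ComplexMultiplication
open Literature.AlgebraicGeometry.Motives (AbelianVariety CMType)
open Literature.AlgebraicGeometry.HodgeTheory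
open Literature.AlgebraicGeometry.ComplexMultiplication (IsCMTypeRealisation isSimple_iff_isPrimitive)
open Literature.AlgebraicGeometry.VanGeemen1994 (hodgeClassSpan)
open Literature.AlgebraicGeometry.Pohlmann1968
open Literature.Barriers.HodgeConjecture (divisorClassesSpan)

/-! ## §1 CM types: curves and one primitive type of degree `≤ 6` or `2p` -/

section Fields

variable {I : Type} {K : I → Type} [∀ i, Field (K i)] [∀ i, NumberField (K i)] [∀ i, IsCMField (K i)] [Fintype I]
  [DecidableEq I] [Nonempty I]

/-- **Curves and one primitive type of degree `≤ 6`: nondegenerate iff no curve field embeds.**  Let all slots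
`a ≠ b` be imaginary quadratic with a separating sub-family of types (pairwise non-isogenous CM elliptic curves), and
`Φ_b` PRIMITIVE on `K_b` with `[K_b : ℚ] ≤ 6` (so `Φ_b` is nondegenerate: Ribet's bound).  Then `(Φ_i)_i` is
nondegenerate iff no `K_a` (`a ≠ b`) embeds in `K_b`. [cite: MoonenZarhin1999LowDim, Thm. (0.2) (a) and (4)]
[cite: Ribet1980, §3 Examples (3.7) (p. 87)] -/
theorem isNondegenerateFamily_iff_forall_isEmpty_of_finrank_le_six (b : I) (Φ : ∀ i, CMType (K i))
    (h2 : ∀ j, j ≠ b → Module.finrank ℚ (K j) = 2)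
    (hsep : CMAlgebra.IsSeparatingFamily (fun j : {j // j ≠ b} => Φ j.1))
    (h6 : Module.finrank ℚ (K b) ≤ 6) (φ₀ : K b →+* ℂ) (hprim : IsPrimitive (ℂ ≃+* ℂ) (Φ b).1 φ₀) :
    CMAlgebra.IsNondegenerateFamily Φ ↔ ∀ a, a ≠ b → IsEmpty (K a →+* K b) := by
  rw [isNondegenerateFamily_iff_forall_isEmpty_single b Φ h2
    (exists_not_iff_of_isSeparatingFamily (fun i => i = b) Φ h2 hsep)]
  exact ⟨fun H => H.2, fun H => ⟨isNondegenerate_of_isPrimitive_of_finrank_le_six (Φ b) h6 φ₀ hprim, H⟩⟩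

/-- **Curves and one primitive type of degree `2p`, `p` prime (Yanai): nondegenerate iff no curve field embeds.**
[cite: MoonenZarhin1999LowDim, Thm. (0.2) (a) and (4)] [cite: Yanai1985, §4 Theorem (p. 171)] -/
theorem isNondegenerateFamily_iff_forall_isEmpty_of_prime (b : I) (Φ : ∀ i, CMType (K i))
    (h2 : ∀ j, j ≠ b → Module.finrank ℚ (K j) = 2)
    (hsep : CMAlgebra.IsSeparatingFamily (fun j : {j // j ≠ b} => Φ j.1)) {p : ℕ} (hp : p.Prime)
    (hK : Module.finrank ℚ (K b) = 2 * p) (φ₀ : K b →+* ℂ) (hprim : IsPrimitive (ℂ ≃+* ℂ) (Φ b).1 φ₀) :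
    CMAlgebra.IsNondegenerateFamily Φ ↔ ∀ a, a ≠ b → IsEmpty (K a →+* K b) := by
  rw [isNondegenerateFamily_iff_forall_isEmpty_single b Φ h2
    (exists_not_iff_of_isSeparatingFamily (fun i => i = b) Φ h2 hsep)]
  exact ⟨fun H => H.2, fun H => ⟨isNondegenerate_of_isPrimitive_of_prime hp hK φ₀ hprim, H⟩⟩

/-- **Rank additivity**: with foreign curve fields, `rank((Φ_i)_i) + |I| = Σ_i rank(Φ_i) + 1` — for `Φ_b` nondegenerate of
degree `2g` this reads `rank Hg(∏_a E_a × A_b) = r + g` (`r` curves). [cite: MoonenZarhin1999LowDim, Thm. (0.2) (4)]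
[cite: Gordon1999HodgeAVSurvey, §3 Theorem (1)] -/
theorem cmFamilyRank_add_card_eq_of_forall_isEmpty (b : I) (Φ : ∀ i, CMType (K i))
    (h2 : ∀ j, j ≠ b → Module.finrank ℚ (K j) = 2)
    (hsep : CMAlgebra.IsSeparatingFamily (fun j : {j // j ≠ b} => Φ j.1))
    (hfor : ∀ a, a ≠ b → IsEmpty (K a →+* K b)) :
    CMAlgebra.cmFamilyRank Φ + Fintype.card I = (∑ i, cmTypeRank (Φ i)) + 1 :=
  cmFamilyRank_add_card_eq_of_menu₃ (fun i => i = b) Φ h2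
    (exists_not_iff_of_isSeparatingFamily (fun i => i = b) Φ h2 hsep) (fun a _ ha hc => hc ▸ hfor a (hc ▸ ha))
    (fun _ _ ha hc hac => (hac (ha.trans hc.symm)).elim)

end Fields

/-! ## §2 Abelian varieties: pairwise non-isogenous CM elliptic curves and one simple CM abelian variety -/

section Geometry

variable {I : Type} {K : I → Type} [∀ i, Field (K i)] [∀ i, NumberField (K i)] [∀ i, IsCMField (K i)] [Fintype I]
  [DecidableEq I] [Nonempty I] {Φ : ∀ i, CMType (K i)}
variable {A : I → AbelianVariety ℂ} {ι : ∀ i, 𝓞 (K i) →+* End (A i)}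
  {θ : ∀ i, K i →+* Module.End ℂ (complexBetti (A i).X 1)}

omit [∀ i, IsCMField (K i)] [Fintype I] [DecidableEq I] [Nonempty I] in
/-- The realisation in a slot with `[K_j : ℚ] = 2` is an elliptic curve (`[K : ℚ] = 2 dim A`). [cite: Shimura1998, §5.2] -/
theorem dim_eq_one_of_finrank_eq_two_slot (hA : ∀ i, IsCMTypeRealisation (Φ i) (A i) (ι i) (θ i)) {j : I}
    (h2 : Module.finrank ℚ (K j) = 2) : (A j).dim = 1 := by
  have h := Literature.AlgebraicGeometry.Pohlmann1968.finrank_eq_two_mul_dim_of_isCMTypeRealisation (hA j)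
  rw [h2] at h
  omega

omit [Fintype I] [DecidableEq I] [Nonempty I] in
/-- **Pairwise non-isogenous CM elliptic curves and ONE simple CM abelian variety of dimension `≠ 1` carry a SEPARATING
family of CM types** (every CM elliptic curve is simple — its quadratic type is nondegenerate, hence primitive, Shimura
Prop. 26; a curve is not isogenous to `A_b` for dimension reasons). [cite: Gordon1999HodgeAVSurvey, 7.4]
[cite: Shimura1998, §8.2 Prop. 26] -/
theorem isSeparatingFamily_of_curves_of_isSimple (b : I) (h2 : ∀ j, j ≠ b → Module.finrank ℚ (K j) = 2)
    (hA : ∀ i, IsCMTypeRealisation (Φ i) (A i) (ι i) (θ i))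
    (hni : ∀ i j, i ≠ b → j ≠ b → i ≠ j → ¬AbelianVariety.IsIsogenous (A i) (A j)) (hS : (A b).IsSimple)
    (hb : (A b).dim ≠ 1) : CMAlgebra.IsSeparatingFamily Φ := by
  have hs : ∀ i, (A i).IsSimple := fun i => by
    by_cases hi : i = b
    · subst hi; exact hS
    · obtain ⟨s₀⟩ : Nonempty (K i →+* ℂ) := inferInstance
      exact (isSimple_iff_isPrimitive (hA i) s₀).2 ((isNondegenerate_of_finrank_eq_two (Φ i) (h2 i hi)).isPrimitive s₀)
  refine CMAlgebra.isSeparatingFamily_of_isSimple_of_pairwise_not_isIsogenous hA hs fun i j hij hiso => ?_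
  have hd := Literature.AlgebraicGeometry.Motives.AbelianVariety.dim_eq_of_isIsogenous_holds (A := A i) (B := A j) hiso
  by_cases hi : i = b
  · subst hi
    exact hb (hd.trans (dim_eq_one_of_finrank_eq_two_slot hA (h2 j (Ne.symm hij))))
  · by_cases hj : j = b
    · subst hj
      exact hb (hd.symm.trans (dim_eq_one_of_finrank_eq_two_slot hA (h2 i hi)))
    · exact hni i j hi hj hij hiso

omit [Fintype I] [DecidableEq I] [Nonempty I] in
/-- A simple CM abelian variety of dimension `≤ 3` realises a NONDEGENERATE type (primitive by Shimura Prop. 26;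
nondegenerate by Ribet's bound in degree `≤ 6`). [cite: Ribet1980, §3 Examples (3.7) (p. 87)] [cite: Shimura1998, §8.2 Prop. 26] -/
theorem isNondegenerate_of_isSimple_of_dim_le_three_slot (hA : ∀ i, IsCMTypeRealisation (Φ i) (A i) (ι i) (θ i))
    {b : I} (hS : (A b).IsSimple) (h3 : (A b).dim ≤ 3) : IsNondegenerate (Φ b) := by
  obtain ⟨s₀⟩ : Nonempty (K b →+* ℂ) := inferInstance
  refine isNondegenerate_of_isPrimitive_of_finrank_le_six (Φ b) ?_ s₀ ((isSimple_iff_isPrimitive (hA b) s₀).1 hS)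
  rw [Literature.AlgebraicGeometry.Pohlmann1968.finrank_eq_two_mul_dim_of_isCMTypeRealisation (hA b)]
  omega

omit [Fintype I] [DecidableEq I] [Nonempty I] in
/-- A simple CM abelian variety of PRIME dimension realises a nondegenerate type (Yanai). [cite: Yanai1985, §4 Theorem (p. 171)]
[cite: Shimura1998, §8.2 Prop. 26] -/
theorem isNondegenerate_of_isSimple_of_prime_slot (hA : ∀ i, IsCMTypeRealisation (Φ i) (A i) (ι i) (θ i))
    {b : I} (hS : (A b).IsSimple) (hp : (A b).dim.Prime) : IsNondegenerate (Φ b) := by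
  obtain ⟨s₀⟩ : Nonempty (K b →+* ℂ) := inferInstance
  exact isNondegenerate_of_isPrimitive_of_prime hp
    (Literature.AlgebraicGeometry.Pohlmann1968.finrank_eq_two_mul_dim_of_isCMTypeRealisation (hA b)) s₀
    ((isSimple_iff_isPrimitive (hA b) s₀).1 hS)

/-- **`B• = D•` on EVERY product iff no curve field embeds — nondegenerate big slot.**  For pairwise non-isogenous CM
elliptic curves `E_a = A_a` (`a ≠ b`) and ONE simple CM abelian variety `A_b` of dimension `≠ 1` realising a
NONDEGENERATE type: `Bᵐ(⨁_{j<N} A_{π j}) ⊗ ℂ = Dᵐ ⊗ ℂ` for all `N, π, m` (all `∏_a E_a^{k_a} × A_b^c`) iff no `K_a`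
embeds in `K_b`. [cite: MoonenZarhin1999LowDim, Thm. (0.2) (a) and (4)] [cite: Gordon1999HodgeAVSurvey, 7.5] -/
theorem forall_prod_hodgeClassSpan_eq_iff_forall_isEmpty_of_isNondegenerate (b : I)
    (h2 : ∀ j, j ≠ b → Module.finrank ℚ (K j) = 2) (hA : ∀ i, IsCMTypeRealisation (Φ i) (A i) (ι i) (θ i))
    (hni : ∀ i j, i ≠ b → j ≠ b → i ≠ j → ¬AbelianVariety.IsIsogenous (A i) (A j)) (hS : (A b).IsSimple)
    (hb : (A b).dim ≠ 1) (hΦ : IsNondegenerate (Φ b)) :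
    (∀ (N : ℕ) (π : Fin N → I) (m : ℕ),
      hodgeClassSpan (⨁ fun j : Fin N => A (π j)).dim (⨁ fun j : Fin N => A (π j)).X m =
        divisorClassesSpan (⨁ fun j : Fin N => A (π j)).X (⨁ fun j : Fin N => A (π j)).dim m) ↔
      ∀ a, a ≠ b → IsEmpty (K a →+* K b) := by
  rw [forall_prod_hodgeClassSpan_eq_iff_forall_isEmpty (fun i => i = b) h2
    (isSeparatingFamily_of_curves_of_isSimple b h2 hA hni hS hb) (fun _ _ ha hc hac => (hac (ha.trans hc.symm)).elim) hA]
  refine ⟨fun H a ha => H.2 a b ha rfl, fun H => ⟨?_, ?_⟩⟩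
  · rintro _ rfl; exact hΦ
  · rintro a _ ha rfl; exact H a ha

/-- **Moonen–Zarhin for curves × one simple CM abelian variety of dimension `2` or `3`: `B• = D•` on every product iff no
curve field embeds in `K_b`.** [cite: MoonenZarhin1999LowDim, Thm. (0.2) (a) and (4)] [cite: Ribet1980, §3 Examples (3.7) (p. 87)] -/
theorem forall_prod_hodgeClassSpan_eq_iff_forall_isEmpty_of_isSimple (b : I)
    (h2 : ∀ j, j ≠ b → Module.finrank ℚ (K j) = 2) (hA : ∀ i, IsCMTypeRealisation (Φ i) (A i) (ι i) (θ i))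
    (hni : ∀ i j, i ≠ b → j ≠ b → i ≠ j → ¬AbelianVariety.IsIsogenous (A i) (A j)) (hS : (A b).IsSimple)
    (hb : (A b).dim ≠ 1) (h3 : (A b).dim ≤ 3) :
    (∀ (N : ℕ) (π : Fin N → I) (m : ℕ),
      hodgeClassSpan (⨁ fun j : Fin N => A (π j)).dim (⨁ fun j : Fin N => A (π j)).X m =
        divisorClassesSpan (⨁ fun j : Fin N => A (π j)).X (⨁ fun j : Fin N => A (π j)).dim m) ↔
      ∀ a, a ≠ b → IsEmpty (K a →+* K b) :=
  forall_prod_hodgeClassSpan_eq_iff_forall_isEmpty_of_isNondegenerate b h2 hA hni hS hb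
    (isNondegenerate_of_isSimple_of_dim_le_three_slot hA hS h3)

/-- **The same for a simple CM abelian variety of PRIME dimension** (Yanai). [cite: MoonenZarhin1999LowDim, Thm. (0.2) (a) and (4)]
[cite: Yanai1985, §4 Theorem (p. 171)] -/
theorem forall_prod_hodgeClassSpan_eq_iff_forall_isEmpty_of_prime (b : I)
    (h2 : ∀ j, j ≠ b → Module.finrank ℚ (K j) = 2) (hA : ∀ i, IsCMTypeRealisation (Φ i) (A i) (ι i) (θ i))
    (hni : ∀ i j, i ≠ b → j ≠ b → i ≠ j → ¬AbelianVariety.IsIsogenous (A i) (A j)) (hS : (A b).IsSimple)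
    (hp : (A b).dim.Prime) :
    (∀ (N : ℕ) (π : Fin N → I) (m : ℕ),
      hodgeClassSpan (⨁ fun j : Fin N => A (π j)).dim (⨁ fun j : Fin N => A (π j)).X m =
        divisorClassesSpan (⨁ fun j : Fin N => A (π j)).X (⨁ fun j : Fin N => A (π j)).dim m) ↔
      ∀ a, a ≠ b → IsEmpty (K a →+* K b) :=
  forall_prod_hodgeClassSpan_eq_iff_forall_isEmpty_of_isNondegenerate b h2 hA hni hS (fun h => hp.ne_one h)
    (isNondegenerate_of_isSimple_of_prime_slot hA hS hp)

/-- **The Hodge conjecture for every `∏_a E_a^{k_a} × A_b^c` when no curve field embeds in `K_b`** (`A_b` simple CM of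
dimension `≠ 1` with a nondegenerate type) — unconditionally. [cite: MoonenZarhin1999LowDim, Thm. (0.2) (4)]
[cite: Gordon1999HodgeAVSurvey, 10.10] -/
theorem hodgeConjectureFor_prod_of_forall_isEmpty_of_isNondegenerate (b : I)
    (h2 : ∀ j, j ≠ b → Module.finrank ℚ (K j) = 2) (hA : ∀ i, IsCMTypeRealisation (Φ i) (A i) (ι i) (θ i))
    (hni : ∀ i j, i ≠ b → j ≠ b → i ≠ j → ¬AbelianVariety.IsIsogenous (A i) (A j)) (hS : (A b).IsSimple)
    (hb : (A b).dim ≠ 1) (hΦ : IsNondegenerate (Φ b)) (hfor : ∀ a, a ≠ b → IsEmpty (K a →+* K b)) {N : ℕ}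
    (π : Fin N → I) : HodgeConjectureFor (⨁ fun j : Fin N => A (π j)).dim (⨁ fun j : Fin N => A (π j)).X := by
  have hsep := isSeparatingFamily_of_curves_of_isSimple b h2 hA hni hS hb
  have hnd : CMAlgebra.IsNondegenerateFamily Φ :=
    (isNondegenerateFamily_iff_forall_isEmpty_single b Φ h2
      (exists_not_iff_of_isSeparatingFamily (fun i => i = b) Φ h2 (isSeparatingFamily_subtype hsep _))).2 ⟨hΦ, hfor⟩
  exact hnd.hodgeConjectureFor_prod hA π

/-- **The Hodge conjecture for every `∏_a E_a^{k_a} × A_b^c`, `A_b` simple CM of dimension `2` or `3`, when no curve field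
embeds in `K_b`** — e.g. a simple CM THREEFOLD `T` with ANY sextic CM field `K` and pairwise non-isogenous CM elliptic
curves with fields `k_a ↪̸ K`: Moonen–Zarhin (0.2) (4) in the CM case. [cite: MoonenZarhin1999LowDim, Thm. (0.2) (4)]
[cite: Ribet1980, §3 Examples (3.7) (p. 87)] -/
theorem hodgeConjectureFor_prod_of_forall_isEmpty_of_isSimple (b : I)
    (h2 : ∀ j, j ≠ b → Module.finrank ℚ (K j) = 2) (hA : ∀ i, IsCMTypeRealisation (Φ i) (A i) (ι i) (θ i))
    (hni : ∀ i j, i ≠ b → j ≠ b → i ≠ j → ¬AbelianVariety.IsIsogenous (A i) (A j)) (hS : (A b).IsSimple)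
    (hb : (A b).dim ≠ 1) (h3 : (A b).dim ≤ 3) (hfor : ∀ a, a ≠ b → IsEmpty (K a →+* K b)) {N : ℕ}
    (π : Fin N → I) : HodgeConjectureFor (⨁ fun j : Fin N => A (π j)).dim (⨁ fun j : Fin N => A (π j)).X :=
  hodgeConjectureFor_prod_of_forall_isEmpty_of_isNondegenerate b h2 hA hni hS hb
    (isNondegenerate_of_isSimple_of_dim_le_three_slot hA hS h3) hfor π

/-- **Prime dimension**: the Hodge conjecture for every `∏_a E_a^{k_a} × A_b^c`, `A_b` simple CM of prime dimension, when no
curve field embeds in `K_b`. [cite: MoonenZarhin1999LowDim, Thm. (0.2) (4)] [cite: Yanai1985, §4 Theorem (p. 171)] -/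
theorem hodgeConjectureFor_prod_of_forall_isEmpty_of_prime (b : I)
    (h2 : ∀ j, j ≠ b → Module.finrank ℚ (K j) = 2) (hA : ∀ i, IsCMTypeRealisation (Φ i) (A i) (ι i) (θ i))
    (hni : ∀ i j, i ≠ b → j ≠ b → i ≠ j → ¬AbelianVariety.IsIsogenous (A i) (A j)) (hS : (A b).IsSimple)
    (hp : (A b).dim.Prime) (hfor : ∀ a, a ≠ b → IsEmpty (K a →+* K b)) {N : ℕ} (π : Fin N → I) :
    HodgeConjectureFor (⨁ fun j : Fin N => A (π j)).dim (⨁ fun j : Fin N => A (π j)).X :=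
  hodgeConjectureFor_prod_of_forall_isEmpty_of_isNondegenerate b h2 hA hni hS (fun h => hp.ne_one h)
    (isNondegenerate_of_isSimple_of_prime_slot hA hS hp) hfor π

omit [DecidableEq I] in
/-- **An embedding `K_a ↪ K_b` forces an exceptional Hodge class** (Moonen–Zarhin's case (a): the Weil classes of
`k = K_a` are really needed): for pairwise non-isogenous CM elliptic curves and one simple CM `A_b` of dimension `≠ 1`,
if some curve field embeds in `K_b` then some product `⨁_{j<N} A_{π j}` carries a rational `(m,m)`-class OUTSIDE
`Dᵐ ⊗ ℂ` (whatever the types). [cite: MoonenZarhin1999LowDim, Thm. (0.2) (a) and (1)] [cite: Gordon1999HodgeAVSurvey, 7.5–7.7] -/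
theorem exists_exceptional_prod_of_ringHom_of_isSimple (b : I)
    (h2 : ∀ j, j ≠ b → Module.finrank ℚ (K j) = 2) (hA : ∀ i, IsCMTypeRealisation (Φ i) (A i) (ι i) (θ i))
    (hni : ∀ i j, i ≠ b → j ≠ b → i ≠ j → ¬AbelianVariety.IsIsogenous (A i) (A j)) (hS : (A b).IsSimple)
    (hb : (A b).dim ≠ 1) {a : I} (ha : a ≠ b) (j : K a →+* K b) :
    ∃ (N : ℕ) (π : Fin N → I) (m : ℕ) (c : complexBetti (⨁ fun j : Fin N => A (π j)).X (2 * m)),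
      IsRationalClass c ∧
      IsOfHodgeType (⨁ fun j : Fin N => A (π j)).dim (⨁ fun j : Fin N => A (π j)).X (2 * m) m m c ∧
      c ∉ divisorClassesSpan (⨁ fun j : Fin N => A (π j)).X (⨁ fun j : Fin N => A (π j)).dim m :=
  CMAlgebra.exists_exceptional_prod_of_not_isNondegenerateFamily
    (isSeparatingFamily_of_curves_of_isSimple b h2 hA hni hS hb)
    (not_isNondegenerateFamily_of_shared_imaginary_quadratic (k := K a) (h2 a ha) ha (RingHom.id (K a)) j Φ) hA

/-- **The dichotomy** (Moonen–Zarhin (0.2) (4) versus (a), CM case, curves × one simple CM abelian variety with a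
nondegenerate type): EITHER every `∏_a E_a^{k_a} × A_b^c` satisfies the Hodge conjecture with `B• = D•`, OR some curve
field embeds in `K_b` and some such product carries an exceptional Hodge class.
[cite: MoonenZarhin1999LowDim, Thm. (0.2) (a) and (4)] [cite: Gordon1999HodgeAVSurvey, 7.5 and 10.10] -/
theorem hodgeConjectureFor_prod_or_exists_exceptional_of_isNondegenerate (b : I)
    (h2 : ∀ j, j ≠ b → Module.finrank ℚ (K j) = 2) (hA : ∀ i, IsCMTypeRealisation (Φ i) (A i) (ι i) (θ i))
    (hni : ∀ i j, i ≠ b → j ≠ b → i ≠ j → ¬AbelianVariety.IsIsogenous (A i) (A j)) (hS : (A b).IsSimple)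
    (hb : (A b).dim ≠ 1) (hΦ : IsNondegenerate (Φ b)) :
    (∀ (N : ℕ) (π : Fin N → I), HodgeConjectureFor (⨁ fun j : Fin N => A (π j)).dim (⨁ fun j : Fin N => A (π j)).X ∧
        ∀ m : ℕ, hodgeClassSpan (⨁ fun j : Fin N => A (π j)).dim (⨁ fun j : Fin N => A (π j)).X m =
          divisorClassesSpan (⨁ fun j : Fin N => A (π j)).X (⨁ fun j : Fin N => A (π j)).dim m) ∨
      ((∃ a, a ≠ b ∧ Nonempty (K a →+* K b)) ∧
        ∃ (N : ℕ) (π : Fin N → I) (m : ℕ) (c : complexBetti (⨁ fun j : Fin N => A (π j)).X (2 * m)),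
          IsRationalClass c ∧
          IsOfHodgeType (⨁ fun j : Fin N => A (π j)).dim (⨁ fun j : Fin N => A (π j)).X (2 * m) m m c ∧
          c ∉ divisorClassesSpan (⨁ fun j : Fin N => A (π j)).X (⨁ fun j : Fin N => A (π j)).dim m) := by
  by_cases hfor : ∀ a, a ≠ b → IsEmpty (K a →+* K b)
  · refine Or.inl fun N π => ⟨hodgeConjectureFor_prod_of_forall_isEmpty_of_isNondegenerate b h2 hA hni hS hb hΦ hfor π,
      fun m => ?_⟩
    exact (forall_prod_hodgeClassSpan_eq_iff_forall_isEmpty_of_isNondegenerate b h2 hA hni hS hb hΦ).2 hfor N π m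
  · push Not at hfor
    obtain ⟨a, ha, ⟨j⟩⟩ := hfor
    exact Or.inr ⟨⟨a, ha, ⟨j⟩⟩, exists_exceptional_prod_of_ringHom_of_isSimple b h2 hA hni hS hb ha j⟩

/-- **The dichotomy for `A_b` simple CM of dimension `2` or `3`.** [cite: MoonenZarhin1999LowDim, Thm. (0.2) (a) and (4)]
[cite: Ribet1980, §3 Examples (3.7) (p. 87)] -/
theorem hodgeConjectureFor_prod_or_exists_exceptional_of_isSimple (b : I)
    (h2 : ∀ j, j ≠ b → Module.finrank ℚ (K j) = 2) (hA : ∀ i, IsCMTypeRealisation (Φ i) (A i) (ι i) (θ i))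
    (hni : ∀ i j, i ≠ b → j ≠ b → i ≠ j → ¬AbelianVariety.IsIsogenous (A i) (A j)) (hS : (A b).IsSimple)
    (hb : (A b).dim ≠ 1) (h3 : (A b).dim ≤ 3) :
    (∀ (N : ℕ) (π : Fin N → I), HodgeConjectureFor (⨁ fun j : Fin N => A (π j)).dim (⨁ fun j : Fin N => A (π j)).X ∧
        ∀ m : ℕ, hodgeClassSpan (⨁ fun j : Fin N => A (π j)).dim (⨁ fun j : Fin N => A (π j)).X m =
          divisorClassesSpan (⨁ fun j : Fin N => A (π j)).X (⨁ fun j : Fin N => A (π j)).dim m) ∨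
      ((∃ a, a ≠ b ∧ Nonempty (K a →+* K b)) ∧
        ∃ (N : ℕ) (π : Fin N → I) (m : ℕ) (c : complexBetti (⨁ fun j : Fin N => A (π j)).X (2 * m)),
          IsRationalClass c ∧
          IsOfHodgeType (⨁ fun j : Fin N => A (π j)).dim (⨁ fun j : Fin N => A (π j)).X (2 * m) m m c ∧
          c ∉ divisorClassesSpan (⨁ fun j : Fin N => A (π j)).X (⨁ fun j : Fin N => A (π j)).dim m) :=
  hodgeConjectureFor_prod_or_exists_exceptional_of_isNondegenerate b h2 hA hni hS hb
    (isNondegenerate_of_isSimple_of_dim_le_three_slot hA hS h3)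

/-! ## §3 The literal fourfold: one CM elliptic curve times one simple CM threefold -/

/-- **Moonen–Zarhin (0.2) for `X = E × T` in the CM case.**  Two slots `a ≠ b` exhausting `I`: `E = A_a` a CM elliptic
curve (`[K_a : ℚ] = 2`) and `T = A_b` a SIMPLE CM THREEFOLD (`[K_b : ℚ] = 6`, any sextic CM field, any primitive type).
Then `Bᵐ ⊗ ℂ = Dᵐ ⊗ ℂ` on EVERY `E^m × T^n` (every `⨁_{j<N} A_{π j}`) iff `k = K_a` does NOT embed in `K = K_b`
(case (4) versus case (a): "there exists an embedding `k ↪ End⁰(X₂)`"). [cite: MoonenZarhin1999LowDim, Thm. (0.2) (a) and (4)] -/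
theorem moonenZarhin_thm02_cm_threefold {a b : I} (hab : a ≠ b) (hI : ∀ i, i = a ∨ i = b)
    (h2 : Module.finrank ℚ (K a) = 2) (h6 : Module.finrank ℚ (K b) = 6)
    (hA : ∀ i, IsCMTypeRealisation (Φ i) (A i) (ι i) (θ i)) (hT : (A b).IsSimple) :
    (∀ (N : ℕ) (π : Fin N → I) (m : ℕ),
      hodgeClassSpan (⨁ fun j : Fin N => A (π j)).dim (⨁ fun j : Fin N => A (π j)).X m =
        divisorClassesSpan (⨁ fun j : Fin N => A (π j)).X (⨁ fun j : Fin N => A (π j)).dim m) ↔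
      IsEmpty (K a →+* K b) := by
  have h2' : ∀ j, j ≠ b → Module.finrank ℚ (K j) = 2 := fun j hj => by
    rcases hI j with rfl | rfl
    · exact h2
    · exact (hj rfl).elim
  have hdim : (A b).dim = 3 := by
    have h := Literature.AlgebraicGeometry.Pohlmann1968.finrank_eq_two_mul_dim_of_isCMTypeRealisation (hA b)
    rw [h6] at h
    omega
  rw [forall_prod_hodgeClassSpan_eq_iff_forall_isEmpty_of_isSimple b h2' hA
    (fun i j hi hj hij => by
      rcases hI i with rfl | rfl
      · rcases hI j with rfl | rfl
        · exact (hij rfl).elim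
        · exact (hj rfl).elim
      · exact (hi rfl).elim)
    hT (by rw [hdim]; decide) (by rw [hdim])]
  refine ⟨fun H => H a hab, fun H c hc => ?_⟩
  rcases hI c with rfl | rfl
  · exact H
  · exact (hc rfl).elim

/-- **The Hodge conjecture for every `E^m × T^n`**, `E` a CM elliptic curve whose field does not embed in the sextic CM
field of the simple CM threefold `T` — unconditionally (Moonen–Zarhin (0.2) (4), CM case).
[cite: MoonenZarhin1999LowDim, Thm. (0.2) (4)] [cite: Gordon1999HodgeAVSurvey, 10.10] -/
theorem hodgeConjectureFor_prod_curve_threefold_of_isEmpty {a b : I} (hab : a ≠ b) (hI : ∀ i, i = a ∨ i = b)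
    (h2 : Module.finrank ℚ (K a) = 2) (h6 : Module.finrank ℚ (K b) = 6)
    (hA : ∀ i, IsCMTypeRealisation (Φ i) (A i) (ι i) (θ i)) (hT : (A b).IsSimple) (he : IsEmpty (K a →+* K b))
    {N : ℕ} (π : Fin N → I) : HodgeConjectureFor (⨁ fun j : Fin N => A (π j)).dim (⨁ fun j : Fin N => A (π j)).X := by
  have h2' : ∀ j, j ≠ b → Module.finrank ℚ (K j) = 2 := fun j hj => by
    rcases hI j with rfl | rfl
    · exact h2
    · exact (hj rfl).elim
  have hdim : (A b).dim = 3 := by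
    have h := Literature.AlgebraicGeometry.Pohlmann1968.finrank_eq_two_mul_dim_of_isCMTypeRealisation (hA b)
    rw [h6] at h
    omega
  refine hodgeConjectureFor_prod_of_forall_isEmpty_of_isSimple b h2' hA
    (fun i j hi hj hij => ?_) hT (by rw [hdim]; decide) (by rw [hdim]) (fun c hc => ?_) π
  · rcases hI i with rfl | rfl
    · rcases hI j with rfl | rfl
      · exact (hij rfl).elim
      · exact (hj rfl).elim
    · exact (hi rfl).elim
  · rcases hI c with rfl | rfl
    · exact he
    · exact (hc rfl).elim

omit [DecidableEq I] in
/-- **Case (a): `k ↪ K` forces an exceptional Hodge class on some `E^m × T^n`** (the Weil classes of `k`).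
[cite: MoonenZarhin1999LowDim, Thm. (0.2) (a) and (1)] -/
theorem exists_exceptional_prod_curve_threefold_of_ringHom {a b : I} (hab : a ≠ b) (hI : ∀ i, i = a ∨ i = b)
    (h2 : Module.finrank ℚ (K a) = 2) (h6 : Module.finrank ℚ (K b) = 6)
    (hA : ∀ i, IsCMTypeRealisation (Φ i) (A i) (ι i) (θ i)) (hT : (A b).IsSimple) (e : K a →+* K b) :
    ∃ (N : ℕ) (π : Fin N → I) (m : ℕ) (c : complexBetti (⨁ fun j : Fin N => A (π j)).X (2 * m)),
      IsRationalClass c ∧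
      IsOfHodgeType (⨁ fun j : Fin N => A (π j)).dim (⨁ fun j : Fin N => A (π j)).X (2 * m) m m c ∧
      c ∉ divisorClassesSpan (⨁ fun j : Fin N => A (π j)).X (⨁ fun j : Fin N => A (π j)).dim m := by
  have h2' : ∀ j, j ≠ b → Module.finrank ℚ (K j) = 2 := fun j hj => by
    rcases hI j with rfl | rfl
    · exact h2
    · exact (hj rfl).elim
  have hdim : (A b).dim = 3 := by
    have h := Literature.AlgebraicGeometry.Pohlmann1968.finrank_eq_two_mul_dim_of_isCMTypeRealisation (hA b)
    rw [h6] at h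
    omega
  refine exists_exceptional_prod_of_ringHom_of_isSimple b h2' hA (fun i j hi hj hij => ?_) hT (by rw [hdim]; decide)
    hab e
  rcases hI i with rfl | rfl
  · rcases hI j with rfl | rfl
    · exact (hij rfl).elim
    · exact (hj rfl).elim
  · exact (hi rfl).elim

end Geometry

end Summit.HodgeConjecture.CorCM

end
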